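import Summits.RiemannHypothesis.RiemannHypothesis.Theses.SpectralTrace
import Summits.RiemannHypothesis.RiemannHypothesis.Theorems.SpectralTraceSpectralConverse
import Literature.NumberTheory.LFunctions.RiemannXi
import Literature.NumberTheory.LFunctions.RiemannXiProofs
import Literature.NumberTheory.LFunctions.XiMoments
import Literature.Analysis.Complex.HadamardGenusZero

/-!
# Sketch (crux-ideate r2 k5) — idea `degua-level-one-cut` for crux `SpectralThesis` (stmt-RiemannHypothesis-0187)

First lemmas of the line, typed over existing declarations; the composition to the crux is
kernel-checked (no `sorry`).  Nothing here is registered; a crux-plan seat would turn the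
`def`s below into `stub_*` theorems.

* `XiPrimeOnLine`      (A)  : every zero of `Ξ′` is real  (⇔ every zero of `ξ′(s)` has `Re s = 1/2`).
* `NoWrongSignExtremum` (B) : at every real critical point `x` of `t ↦ Ξ(t)`, `Ξ(x)·Ξ″(x) < 0`.
* `DeGuaClosure`            : A → B → RH  (Pólya 1930 Thm I with J′ = 0 = de Gua's rule at level one;
                              elementary genus-0 proof in the idea card, over `hadamard_genus_zero_holds`).
* `spectralThesis_of_deGua` : DeGuaClosure → A → B → SpectralThesis   (via the LANDED `spectralConverse_proof`).
-/

noncomputable section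

set_option linter.dupNamespace false

open Complex

namespace Summit.RiemannHypothesis.RiemannHypothesis.Cruxes.SpectralThesis.Ideator5

open Literature.NumberTheory.LFunctions
open Summit.RiemannHypothesis.RiemannHypothesis.Theses.SpectralTrace

/-- `Ξ` restricted to the real line, as a real function (`Ξ` is real there:
`im_riemannXiUpper_ofReal_holds`). -/
def xiR (t : ℝ) : ℝ := (riemannXiUpper (t : ℂ)).re

/-- (A) far-field residual: every zero of `Ξ′` is real, i.e. every zero of `ξ′(s)` lies on the
critical line (RH ⇒ A by Laguerre–Pólya heredity; Conrey 1983: > 81.37 % of them do). -/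
def XiPrimeOnLine : Prop :=
  ∀ z : ℂ, deriv riemannXiUpper z = 0 → z.im = 0

/-- (B) near-field residual: no wrong-sign or degenerate extremum of `Ξ` on `ℝ` — at every real
critical point the first Laguerre inequality is strict (RH ∧ simple zeros ⇒ B; B has been observed
on every computed stretch of Hardy's `Z`). -/
def NoWrongSignExtremum : Prop :=
  ∀ x : ℝ, deriv xiR x = 0 → xiR x * iteratedDeriv 2 xiR x < 0

/-- FIRST LEMMA of the line (provable, RH-free): de Gua's rule at level one for `Ξ`
(Pólya 1930, Quart. J. Math. 1, Thm I, case J′ = 0; Ki–Kim 2000 Duke 104, Thm 4.3 + Remark 4.5).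
Elementary proof (card): pass to `G(w)` with `G(z²) = Ξ(z)` (order 1/2, genus 0,
`hadamard_genus_zero_holds`), `G > 0`, `G′ < 0` on `(-∞,0]` (`iteratedDeriv_two_mul_riemannXi_half_pos`);
B forces exactly one simple critical point per gap of real zeros and none elsewhere; A + genus 0 give
`G′ = G′(0)∏(1 - w/cₖ)`; comparing `log|G′(-x)|` computed from the `cₖ` with
`log G(-x) + log|G′/G(-x)|` computed from all zeros gives `2 log x ≤ log x + O(1)` if one
non-real pair exists. -/
def DeGuaClosure : Prop :=
  XiPrimeOnLine → NoWrongSignExtremum → RiemannHypothesis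

/-- The abstract function-theoretic form of the first lemma (what a `--supports` file would prove
first): genus-0 de Gua at level one.  `F` entire of order `< 1`, real on `ℝ`, positive with negative
derivative on `(-∞, 0]`, all zeros of `deriv F` real, strict Laguerre sign at every real critical
point, and all non-real zeros in the open right half-plane ⇒ all zeros of `F` are real. -/
def GenusZeroDeGua : Prop :=
  ∀ (F : ℂ → ℂ) (ρ C : ℝ), Differentiable ℂ F → ρ < 1 →
    (∀ z : ℂ, ‖F z‖ ≤ C * Real.exp (‖z‖ ^ ρ)) →
    (∀ x : ℝ, (F x).im = 0) →
    (∀ x : ℝ, x ≤ 0 → 0 < (F x).re ∧ (deriv F x).re < 0) →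
    (∀ z : ℂ, deriv F z = 0 → z.im = 0) →
    (∀ x : ℝ, deriv F x = 0 → (F x).re * (iteratedDeriv 2 F x).re < 0) →
    (∀ z : ℂ, F z = 0 → z.im ≠ 0 → 0 < z.re) →
      ∀ z : ℂ, F z = 0 → z.im = 0

/-- KERNEL-CHECKED COMPOSITION to the crux BY NAME: the first lemma and the two residuals give the
route target `SpectralThesis` through the landed `spectralConverse_proof : RH → X`. -/
theorem spectralThesis_of_deGua (hC : DeGuaClosure) (hA : XiPrimeOnLine) (hB : NoWrongSignExtremum) :
    SpectralThesis :=
  Summit.RiemannHypothesis.RiemannHypothesis.Theorems.spectralConverse_proof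
    (_root_.Summit.RiemannHypothesis_iff.mpr (hC hA hB))

/-- Sanity: the converse direction of the crux is already a theorem, so the line's residual content
is exactly A ∧ B ⇒ RH (and RH ∧ simple ⇒ A ∧ B by Laguerre–Pólya heredity, not formalised here). -/
theorem riemannHypothesis_of_deGua (hC : DeGuaClosure) (hA : XiPrimeOnLine) (hB : NoWrongSignExtremum) :
    RiemannHypothesis := hC hA hB

end Summit.RiemannHypothesis.RiemannHypothesis.Cruxes.SpectralThesis.Ideator5
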